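import Summits.CriticalPhenomena.SAWScalingLimit.Theorems.SAWTwistedSelfEnergyParaMartingaleDefs
import Literature.Probability.RandomPlanarGeometry.SAWExplorationFiltration
import Literature.Probability.RandomPlanarGeometry.SAWRestrictionCovariance
import Literature.Probability.RandomPlanarGeometry.SelfAvoidingWalkProofs
import HarnessLib

/-!
# Walk bookkeeping for `stub_paraDoobMartingale` (S1 of the line `parafermionic-martingale`, crux
`SubseqIdentification`, stmt-CriticalPhenomena-0783) — support file, landed first

The registered stub S1 (`Theorems/SAWTwistedSelfEnergySubseqIdentificationParaDoobMartingale.lean`,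
which imports this file) says that the Doob-normalised parafermionic observable
`Q_n = M(γ[0,n], z)/M(γ[0,0], z)` (`paraDoob`; objects `contObs = A`, `contPartition = B`,
`pastObs = M = A/B` of `Theorems/SAWTwistedSelfEnergyParaMartingaleDefs.lean`) of the critical `δℤ²`
self-avoiding walk is an exact exploration martingale on every cylinder without dead first steps.
This file holds the generic combinatorics of that proof (first-step decomposition + domain Markov
property of the weights `x_c^{|γ|}`), for an arbitrary discrete domain `Ω_δ`:

* GLUING / UNGLUING at a self-avoiding past `L : a → v` (`exists_support_eq_append`,
  `exists_support_eq_append_of_take_eq`): the self-avoiding walks `a → w` with prefix `L` are exactly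
  the concatenations `L ⊕ ω` with the self-avoiding continuations `ω : v → w` whose tail avoids `L`
  (Madras–Slade 1993, §1.2), whence the transfer of sums `sum_ite_take_eq_sum_ite_tail` /
  `pow_mul_sum_cont_eq_sum_cyl` (lengths add);
* consequently `M(L, z) = A♯(l)/B♯(l)` (`pastObs_eq_sum_div_sum`, `pastObs_prefixAt_eq`), where
  `A♯(l) = Σ_{η : a → z, η ⊒ l} x_c^{|η|} e^{-i(5/8) W(a' → η)}` and `B♯(l) = Σ_{γ : a → b, γ ⊒ l} x_c^{|γ|}`
  are CYLINDER sums over walks from `a` whose `(|l|)`-prefix of vertices is `l = support L`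
  (the factors `x_c^{|L|}` cancel, `x_c > 0`: `SAW.criticalFugacity_pos_lt_one'`); such a cylinder
  sum with one term is nonzero (`sum_ite_pow_ne_zero`);
* the NO-DEAD-STEP hypothesis of S1 in the form it is consumed (`exists_take_eq_of_noDeadStep`,
  the registered anchor of this file): the `(n+2)`-prefix of every self-avoiding walk `a → z`
  through the `(n+1)`-prefix `l ∌ z` is the `(n+2)`-prefix of a self-avoiding walk `a → b`;
* integrals against the critical law `SAW.law` on the finite SAW space are normalised weighted sums,
  `∫_S f dP_δ = Z⁻¹ Σ_{γ ∈ S} x_c^{|γ|} f(γ)` (`setIntegral_law_eq_of_sum_eq`, all junk cases included).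

Sources: N. Madras, G. Slade, *The Self-Avoiding Walk* (1993) §1.2 (concatenation);
G. F. Lawler, O. Schramm, W. Werner, Proc. Sympos. Pure Math. 72 (2004) §3.4.2 (the critical SAW
measure and its domain Markov property); H. Duminil-Copin, S. Smirnov, Ann. of Math. 175 (2012) §2.
No new definitions, no named facts.
-/

noncomputable section

open MeasureTheory Filter Topology Set
open scoped NNReal ENNReal Classical BigOperators
open Literature.Probability.LatticeModels
open Literature.Probability.RandomPlanarGeometry
open UpperHalfPlane (upperHalfPlaneSet)

namespace Summit.CriticalPhenomena.SAWScalingLimit.Theorems.SubseqIdentification.ParaMartingale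

open Summit.CriticalPhenomena.SAWScalingLimit.Theorems.SubseqIdentification.RoomEntropy (prefixAt)

/-! ## Lists: nested prefixes -/

/-- Two lists with the same `(n+2)`-prefix have the same `(n+1)`-prefix. [folklore] -/
theorem take_eq_of_take_succ_eq {α : Type*} {s s₁ l : List α} {n : ℕ}
    (h1 : s₁.take (n + 1) = l) (h2 : s.take (n + 2) = s₁.take (n + 2)) : s.take (n + 1) = l := by
  have e : ∀ r : List α, r.take (n + 1) = (r.take (n + 2)).take (n + 1) := fun r => by
    rw [List.take_take, Nat.min_eq_left (by omega)]
  rw [e, h2, ← e, h1]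

/-! ## Gluing and ungluing self-avoiding walks at a prefix -/

-- adapted from Summits/CriticalPhenomena/SAWScalingLimit/Theorems/SAWLoopFugacityFlowSimpleSubseqLimitsStubDomainMarkovWalks.lean
-- (`glue`, `exists_glue_eq`), with the avoidance hypothesis per continuation instead of per domain.
/-- **Gluing** (Madras–Slade 1993, §1.2: concatenation): a self-avoiding past `L : a → v` followed
by a self-avoiding continuation `ω : v → w` whose tail avoids `L` is (the support of) a
self-avoiding walk `a → w`. [folklore] -/
theorem exists_support_eq_append {Ω : Set ℂ} {δ : ℝ} {a v w : Site 2}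
    (L : (discreteDomainGraph Ω δ).Walk a v) (hL : L.IsPath) (ω : SAW.DomainSAW Ω δ v w)
    (hω : ∀ x ∈ ω.walk.support.tail, x ∉ L.support) :
    ∃ η : SAW.DomainSAW Ω δ a w, η.walk.support = L.support ++ ω.walk.support.tail := by
  refine ⟨⟨L.append ω.walk, ?_⟩, SimpleGraph.Walk.support_append _ _⟩
  rw [SimpleGraph.Walk.isPath_def, SimpleGraph.Walk.support_append, List.nodup_append]
  refine ⟨(SimpleGraph.Walk.isPath_def _).1 hL,
    ((SimpleGraph.Walk.isPath_def _).1 ω.isPath).sublist (List.tail_sublist _), ?_⟩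
  intro x hx y hy hxy
  subst hxy
  exact hω x hy hx

/-- **Ungluing**: a self-avoiding walk `η : a → w` whose first `|L| + 1` vertices are those of
`L : a → v` is `L` followed by a self-avoiding continuation `v → w` whose tail avoids `L`.
[folklore] -/
theorem exists_support_eq_append_of_take_eq {Ω : Set ℂ} {δ : ℝ} {a v w : Site 2}
    (L : (discreteDomainGraph Ω δ).Walk a v) (η : SAW.DomainSAW Ω δ a w)
    (h : η.walk.support.take (L.length + 1) = L.support) :
    ∃ ω : SAW.DomainSAW Ω δ v w, (∀ x ∈ ω.walk.support.tail, x ∉ L.support) ∧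
      η.walk.support = L.support ++ ω.walk.support.tail := by
  have hlen : L.length ≤ η.walk.length := by
    have h1 := congrArg List.length h
    rw [List.length_take, SimpleGraph.Walk.length_support, SimpleGraph.Walk.length_support] at h1
    omega
  have hv : η.walk.getVert L.length = v := by
    have h1 := SimpleGraph.Walk.getVert_eq_support_getElem? η.walk hlen
    have h2 := SimpleGraph.Walk.getVert_eq_support_getElem? L le_rfl
    rw [SimpleGraph.Walk.getVert_length, ← h, List.getElem?_take, if_pos (Nat.lt_succ_self _),
      ← h1] at h2
    exact (Option.some_injective _ h2).symm
  have hnd : η.walk.support.Nodup := (SimpleGraph.Walk.isPath_def _).1 η.isPath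
  have hsupp : ((η.walk.drop L.length).copy hv rfl).support = η.walk.support.drop L.length := by
    rw [SimpleGraph.Walk.support_copy, SimpleGraph.Walk.drop_support_eq_support_drop_min,
      Nat.min_eq_left hlen]
  refine ⟨⟨(η.walk.drop L.length).copy hv rfl, ?_⟩, ?_, ?_⟩
  · rw [SimpleGraph.Walk.isPath_def, hsupp]
    exact hnd.sublist (List.drop_sublist _ _)
  · intro x hx hxL
    change x ∈ ((η.walk.drop L.length).copy hv rfl).support.tail at hx
    rw [hsupp, List.tail_drop] at hx
    rw [← h] at hxL
    exact List.disjoint_take_drop hnd le_rfl hxL hx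
  · show η.walk.support = L.support ++ ((η.walk.drop L.length).copy hv rfl).support.tail
    rw [hsupp, List.tail_drop, ← h, List.take_append_drop]

/-- **First-passage decomposition of cylinder sums** (the combinatorial domain Markov property):
summing a function of the vertex list over the self-avoiding walks `a → w` with prefix `L` is
summing it over `L ⊕ ω`, `ω : v → w` the self-avoiding continuations whose tail avoids `L`.
[folklore] -/
theorem sum_ite_take_eq_sum_ite_tail {M : Type*} [AddCommMonoid M] {Ω : Set ℂ} {δ : ℝ}
    {a v w : Site 2} [Fintype (SAW.DomainSAW Ω δ a w)] [Fintype (SAW.DomainSAW Ω δ v w)]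
    (L : (discreteDomainGraph Ω δ).Walk a v) (hL : L.IsPath) (Φ : List (Site 2) → M) :
    (∑ η : SAW.DomainSAW Ω δ a w,
        if η.walk.support.take (L.length + 1) = L.support then Φ η.walk.support else 0) =
      ∑ ω : SAW.DomainSAW Ω δ v w,
        if ∀ x ∈ ω.walk.support.tail, x ∉ L.support then Φ (L.support ++ ω.walk.support.tail)
        else 0 := by
  rw [← Finset.sum_filter, ← Finset.sum_filter]
  have hinjS : Set.InjOn (fun η : SAW.DomainSAW Ω δ a w => η.walk.support)
      ↑(Finset.univ.filter fun η : SAW.DomainSAW Ω δ a w =>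
          η.walk.support.take (L.length + 1) = L.support) :=
    fun η _ η' _ h => SAW.DomainSAW.ext_support h
  have hinjT : Set.InjOn (fun ω : SAW.DomainSAW Ω δ v w => L.support ++ ω.walk.support.tail)
      ↑(Finset.univ.filter fun ω : SAW.DomainSAW Ω δ v w =>
          ∀ x ∈ ω.walk.support.tail, x ∉ L.support) := by
    intro ω _ ω' _ h
    apply SAW.DomainSAW.ext_support
    have h' : ω.walk.support.tail = ω'.walk.support.tail := List.append_cancel_left h
    rw [← ω.walk.cons_tail_support, ← ω'.walk.cons_tail_support, h']
  rw [← Finset.sum_image (f := Φ) hinjS, ← Finset.sum_image (f := Φ) hinjT]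
  refine Finset.sum_congr ?_ fun _ _ => rfl
  ext s
  simp only [Finset.mem_image, Finset.mem_filter, Finset.mem_univ, true_and]
  constructor
  · rintro ⟨η, hη, rfl⟩
    obtain ⟨ω, hω, hs⟩ := exists_support_eq_append_of_take_eq L η hη
    exact ⟨ω, hω, hs.symm⟩
  · rintro ⟨ω, hω, rfl⟩
    obtain ⟨η, hη⟩ := exists_support_eq_append L hL ω hω
    refine ⟨η, ?_, hη⟩
    rw [hη]
    exact List.take_left' (SimpleGraph.Walk.length_support _)

/-- The decomposition with the critical weights split off: for `Ψ` a function of the vertex list,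
`x_c^{|L|} Σ_ω x_c^{|ω|} Ψ(L ⊕ ω) = Σ_{η ⊒ L} x_c^{|η|} Ψ(η)` (lengths add under concatenation).
[folklore] -/
theorem pow_mul_sum_cont_eq_sum_cyl {Ω : Set ℂ} {δ : ℝ} {a v w : Site 2}
    [Fintype (SAW.DomainSAW Ω δ a w)] [Fintype (SAW.DomainSAW Ω δ v w)]
    (L : (discreteDomainGraph Ω δ).Walk a v) (hL : L.IsPath) (Ψ : List (Site 2) → ℂ) :
    (SAW.criticalFugacity : ℂ) ^ L.length *
        ∑ ω : SAW.DomainSAW Ω δ v w,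
          (if ∀ x ∈ ω.walk.support.tail, x ∉ L.support then
            (SAW.criticalFugacity : ℂ) ^ ω.length * Ψ (L.append ω.walk).support else 0) =
      ∑ η : SAW.DomainSAW Ω δ a w,
        if η.walk.support.take (L.length + 1) = L.support then
          (SAW.criticalFugacity : ℂ) ^ η.length * Ψ η.walk.support else 0 := by
  have key := sum_ite_take_eq_sum_ite_tail (w := w) L hL
    (fun s => (SAW.criticalFugacity : ℂ) ^ (s.length - 1) * Ψ s)
  have h1 : ∀ η : SAW.DomainSAW Ω δ a w, η.walk.support.length - 1 = η.length := fun η => by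
    rw [SimpleGraph.Walk.length_support]
    rfl
  simp only [h1] at key
  rw [key, Finset.mul_sum]
  refine Finset.sum_congr rfl fun ω _ => ?_
  split_ifs with hav
  · have h2 : (L.support ++ ω.walk.support.tail).length - 1 = L.length + ω.length := by
      rw [List.length_append, List.length_tail, SimpleGraph.Walk.length_support,
        SimpleGraph.Walk.length_support]
      show L.length + 1 + (ω.walk.length + 1 - 1) - 1 = L.length + ω.walk.length
      omega
    rw [h2, pow_add, SimpleGraph.Walk.support_append, mul_assoc]
  · rw [mul_zero]

/-- **`M(L, z) = A♯(L)/B♯(L)`**: the observable of the slit domain rooted at the tip of the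
self-avoiding past `L` (of length `n`, support `l`) is the ratio of the two CYLINDER sums over walks
from `a` with prefix `l` (the factors `x_c^n` cancel, `x_c > 0`). [folklore] -/
theorem pastObs_eq_sum_div_sum {Ω : Set ℂ} {δ : ℝ} {a v : Site 2} (a' b z : Site 2)
    [Fintype (SAW.DomainSAW Ω δ a z)] [Fintype (SAW.DomainSAW Ω δ a b)]
    [Fintype (SAW.DomainSAW Ω δ v z)] [Fintype (SAW.DomainSAW Ω δ v b)]
    (L : (discreteDomainGraph Ω δ).Walk a v) (hL : L.IsPath) {n : ℕ} {l : List (Site 2)}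
    (hn : L.length = n) (hl : L.support = l) :
    pastObs Ω δ a' b L z =
      (∑ η : SAW.DomainSAW Ω δ a z, if η.walk.support.take (n + 1) = l then
          (SAW.criticalFugacity : ℂ) ^ η.length *
            Complex.exp (-Complex.I * (5 / 8 : ℂ) *
              (winding (meshPoint δ a' :: (η.walk.support.map (meshPoint δ))) : ℝ)) else 0) /
      ∑ γ : SAW.DomainSAW Ω δ a b, if γ.walk.support.take (n + 1) = l then
          (SAW.criticalFugacity : ℂ) ^ γ.length else 0 := by
  subst hn hl
  have hx : (SAW.criticalFugacity : ℂ) ^ L.length ≠ 0 :=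
    pow_ne_zero _ (Complex.ofReal_ne_zero.2 SAW.criticalFugacity_pos_lt_one'.1.ne')
  rw [pastObs, ← mul_div_mul_left _ _ hx]
  congr 1
  · rw [contObs, tsum_fintype]
    exact pow_mul_sum_cont_eq_sum_cyl L hL (fun s => Complex.exp (-Complex.I * (5 / 8 : ℂ) *
      (winding (meshPoint δ a' :: (s.map (meshPoint δ))) : ℝ)))
  · rw [contPartition, tsum_fintype, Complex.ofReal_sum]
    have key := pow_mul_sum_cont_eq_sum_cyl (w := b) L hL (fun _ => 1)
    simp only [mul_one] at key
    rw [← key]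
    congr 1
    refine Finset.sum_congr rfl fun ω _ => ?_
    split_ifs <;> simp

/-- `M(γ[0,k], z) = A♯(γ.support.take (k+1))/B♯(γ.support.take (k+1))` for `k ≤ |γ|`: the past
`γ[0,k]` is a self-avoiding walk of length `k` with support the `(k+1)`-prefix of `γ`. [folklore] -/
theorem pastObs_prefixAt_eq {Ω : Set ℂ} {δ : ℝ} {a b : Site 2} (a' z : Site 2)
    [∀ u w : Site 2, Fintype (SAW.DomainSAW Ω δ u w)]
    (γ : SAW.DomainSAW Ω δ a b) {k : ℕ} (hk : k ≤ γ.walk.length) :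
    pastObs Ω δ a' b (prefixAt γ k) z =
      (∑ η : SAW.DomainSAW Ω δ a z,
          if η.walk.support.take (k + 1) = γ.walk.support.take (k + 1) then
            (SAW.criticalFugacity : ℂ) ^ η.length *
              Complex.exp (-Complex.I * (5 / 8 : ℂ) *
                (winding (meshPoint δ a' :: (η.walk.support.map (meshPoint δ))) : ℝ)) else 0) /
      ∑ γ' : SAW.DomainSAW Ω δ a b,
          if γ'.walk.support.take (k + 1) = γ.walk.support.take (k + 1) then
            (SAW.criticalFugacity : ℂ) ^ γ'.length else 0 := by
  have hl : (prefixAt γ k).support = γ.walk.support.take (k + 1) :=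
    SAW.support_takeUntil_getVert γ.isPath k
  have hn : (prefixAt γ k).length = k := by
    have h1 := congrArg List.length hl
    rw [SimpleGraph.Walk.length_support, List.length_take, SimpleGraph.Walk.length_support] at h1
    omega
  exact pastObs_eq_sum_div_sum a' b z (prefixAt γ k) (γ.isPath.takeUntil _) hn hl

/-- A cylinder sum of critical weights `Σ [p γ] x_c^{|γ|}` with at least one term is nonzero
(`x_c > 0`). [folklore] -/
theorem sum_ite_pow_ne_zero {ι : Type*} [Fintype ι] (p : ι → Prop) [DecidablePred p]
    (len : ι → ℕ) {i₀ : ι} (h : p i₀) :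
    (∑ i, if p i then (SAW.criticalFugacity : ℂ) ^ len i else 0) ≠ 0 := by
  have hx : 0 < SAW.criticalFugacity := SAW.criticalFugacity_pos_lt_one'.1
  have hcast : (∑ i, if p i then (SAW.criticalFugacity : ℂ) ^ len i else 0) =
      ((∑ i, if p i then SAW.criticalFugacity ^ len i else 0 : ℝ) : ℂ) := by
    rw [Complex.ofReal_sum]
    refine Finset.sum_congr rfl fun i _ => ?_
    split_ifs <;> simp
  rw [hcast, Complex.ofReal_ne_zero]
  refine ne_of_gt (lt_of_lt_of_le (pow_pos hx (len i₀)) ?_)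
  calc SAW.criticalFugacity ^ len i₀ = (if p i₀ then SAW.criticalFugacity ^ len i₀ else 0) := by
        rw [if_pos h]
    _ ≤ ∑ i, if p i then SAW.criticalFugacity ^ len i else 0 :=
        Finset.single_le_sum (f := fun i => if p i then SAW.criticalFugacity ^ len i else 0)
          (fun i _ => by
            show (0 : ℝ) ≤ if p i then SAW.criticalFugacity ^ len i else 0
            split_ifs
            · exact pow_nonneg hx.le _
            · exact le_rfl)
          (Finset.mem_univ i₀)

/-! ## The no-dead-step hypothesis -/

/-- **No dead first steps ⇒ every child cylinder towards `z` is a child cylinder towards `b`.**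
If `z ∉ l` and every neighbour `u ∉ l` of the tip of `l` from which `z` is reachable avoiding `l`
also reaches `b` avoiding `l`, then the `(n+2)`-prefix of every self-avoiding walk `a → z` through
the `(n+1)`-prefix `l` is the `(n+2)`-prefix of a self-avoiding walk `a → b`. [folklore] -/
theorem exists_take_eq_of_noDeadStep {Ω : Set ℂ} {δ : ℝ} {a b z : Site 2} {n : ℕ}
    {l : List (Site 2)} (hz : z ∉ l)
    (H : ∀ v u : Site 2, l.getLast? = some v → (discreteDomainGraph Ω δ).Adj v u → u ∉ l →
      (∃ ω : SAW.DomainSAW Ω δ u z, ∀ y ∈ ω.walk.support, y ∉ l) →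
      ∃ ω : SAW.DomainSAW Ω δ u b, ∀ y ∈ ω.walk.support, y ∉ l)
    (η : SAW.DomainSAW Ω δ a z) (hη : η.walk.support.take (n + 1) = l) :
    ∃ γ : SAW.DomainSAW Ω δ a b, γ.walk.support.take (n + 2) = η.walk.support.take (n + 2) := by
  have hnd : η.walk.support.Nodup := (SimpleGraph.Walk.isPath_def _).1 η.isPath
  have hlen : n + 1 ≤ η.walk.length := by
    by_contra hlt
    push Not at hlt
    apply hz
    rw [← hη, List.take_of_length_le
      (show η.walk.support.length ≤ n + 1 by rw [SimpleGraph.Walk.length_support]; omega)]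
    exact η.walk.end_mem_support
  have hl : l.getLast? = some (η.walk.getVert n) := by
    rw [← hη, ← SimpleGraph.Walk.support_take,
      List.getLast?_eq_some_getLast (SimpleGraph.Walk.support_ne_nil _), SimpleGraph.Walk.getLast_support]
  have hadj : (discreteDomainGraph Ω δ).Adj (η.walk.getVert n) (η.walk.getVert (n + 1)) :=
    η.walk.adj_getVert_succ (by omega)
  have hdrop : (η.walk.drop (n + 1)).support = η.walk.support.drop (n + 1) := by
    rw [SimpleGraph.Walk.drop_support_eq_support_drop_min, Nat.min_eq_left hlen]
  have havoid : ∀ y ∈ (η.walk.drop (n + 1)).support, y ∉ l := by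
    intro y hy hyl
    rw [hdrop] at hy
    rw [← hη] at hyl
    exact List.disjoint_take_drop hnd le_rfl hyl hy
  have hu : η.walk.getVert (n + 1) ∉ l := havoid _ (SimpleGraph.Walk.start_mem_support _)
  have hω₀ : (η.walk.drop (n + 1)).IsPath := by
    rw [SimpleGraph.Walk.isPath_def, hdrop]
    exact hnd.sublist (List.drop_sublist _ _)
  obtain ⟨ω, hω⟩ := H _ _ hl hadj hu ⟨⟨η.walk.drop (n + 1), hω₀⟩, havoid⟩
  have hsupp : ((η.walk.take n).append (SimpleGraph.Walk.cons hadj ω.walk)).support =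
      l ++ ω.walk.support := by
    rw [SimpleGraph.Walk.support_append, SimpleGraph.Walk.support_cons, List.tail_cons,
      SimpleGraph.Walk.support_take, hη]
  refine ⟨⟨(η.walk.take n).append (SimpleGraph.Walk.cons hadj ω.walk), ?_⟩, ?_⟩
  · rw [SimpleGraph.Walk.isPath_def, hsupp, List.nodup_append]
    refine ⟨hη ▸ hnd.sublist (List.take_sublist _ _), (SimpleGraph.Walk.isPath_def _).1 ω.isPath,
      ?_⟩
    intro x hx y hy hxy
    subst hxy
    exact hω x hy hx
  · show ((η.walk.take n).append (SimpleGraph.Walk.cons hadj ω.walk)).support.take (n + 2) =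
      η.walk.support.take (n + 2)
    have hl1 : l.length = n + 1 := by
      rw [← hη, List.length_take, SimpleGraph.Walk.length_support]
      omega
    rw [hsupp, List.take_append,
      List.take_of_length_le (show l.length ≤ n + 2 by omega), hl1,
      show n + 2 - (n + 1) = 1 by omega,
      List.take_succ_eq_append_getElem
        (show n + 1 < η.walk.support.length by rw [SimpleGraph.Walk.length_support]; omega),
      hη, ← SimpleGraph.Walk.getVert_eq_support_getElem η.walk hlen, ← ω.walk.cons_tail_support]
    rfl


/-! ## Integrals against the critical law on the finite SAW space -/

/-- **Integrals against `SAW.law` are normalised weighted sums**: on the finite SAW space,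
`∫_S f dP_δ = Z⁻¹ Σ_{γ ∈ S} x_c^{|γ|} f(γ)` (all junk cases included), so two functions with the
same weighted sum over `S` have the same integral over `S`. [folklore] -/
theorem setIntegral_law_eq_of_sum_eq {Ω : Set ℂ} {δ : ℝ} {a b : Site 2}
    [Fintype (SAW.DomainSAW Ω δ a b)] (S : Set (SAW.DomainSAW Ω δ a b))
    {f g : SAW.DomainSAW Ω δ a b → ℂ}
    (h : (∑ γ, if γ ∈ S then (SAW.criticalFugacity : ℂ) ^ γ.length * f γ else 0) =
      ∑ γ, if γ ∈ S then (SAW.criticalFugacity : ℂ) ^ γ.length * g γ else 0) :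
    ∫ γ in S, f γ ∂(SAW.law Ω δ a b) = ∫ γ in S, g γ ∂(SAW.law Ω δ a b) := by
  haveI : MeasurableSingletonClass (SAW.DomainSAW Ω δ a b) :=
    ⟨fun _ => MeasurableSpace.measurableSet_top⟩
  have hle : ∀ T : Set (SAW.DomainSAW Ω δ a b), SAW.law Ω δ a b T ≤ 1 := fun T => by
    rw [SAW.law_apply_eq_inv_mul_weight]
    calc (SAW.weight Ω δ a b univ)⁻¹ * SAW.weight Ω δ a b T
        ≤ (SAW.weight Ω δ a b univ)⁻¹ * SAW.weight Ω δ a b univ := by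
          gcongr
          exact subset_univ _
      _ ≤ 1 := ENNReal.inv_mul_le_one _
  haveI : IsFiniteMeasure (SAW.law Ω δ a b) := ⟨(hle univ).trans_lt ENNReal.one_lt_top⟩
  have hx0 : 0 ≤ SAW.criticalFugacity := SAW.criticalFugacity_pos_lt_one'.1.le
  have key : ∀ φ : SAW.DomainSAW Ω δ a b → ℂ, ∫ γ in S, φ γ ∂(SAW.law Ω δ a b) =
      ((SAW.weight Ω δ a b univ)⁻¹).toReal •
        ∑ γ, if γ ∈ S then (SAW.criticalFugacity : ℂ) ^ γ.length * φ γ else 0 := by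
    intro φ
    rw [integral_fintype Integrable.of_finite, Finset.smul_sum]
    refine Finset.sum_congr rfl fun γ _ => ?_
    rw [measureReal_def, Measure.restrict_apply (MeasurableSet.singleton γ)]
    by_cases hγ : γ ∈ S
    · rw [Set.inter_eq_left.2 (Set.singleton_subset_iff.2 hγ), if_pos hγ,
        SAW.law_apply_eq_inv_mul_weight, SAW.weight_singleton, ENNReal.toReal_mul,
        ENNReal.toReal_ofReal (pow_nonneg hx0 _)]
      simp only [mul_smul, Complex.real_smul, Complex.ofReal_pow]
    · rw [Set.singleton_inter_eq_empty.2 hγ, measure_empty, ENNReal.toReal_zero, zero_smul,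
        if_neg hγ, smul_zero]
  rw [key f, key g, h]


end Summit.CriticalPhenomena.SAWScalingLimit.Theorems.SubseqIdentification.ParaMartingale

end
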